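import Literature.MathematicalPhysics.QuantumFieldTheory.Balaban1983to89.Node00.Record12NumericsFamilyDictZ
import Literature.MathematicalPhysics.QuantumFieldTheory.Balaban1983to89.Node00.Record13NumericsOfThm1CCMW

/-!
# NODE 00 (YM-PLAN Track A) — STAGE 13, THE z-WITNESS EDITION «Z2»: THE ALL-NUMERICS WITNESS FAMILY WITH THE FLUCTUATION LETTERS `Efl`, `logz`
# (`theta13OfNumericsZ`, `theta13LiveOfNumericsZ`), THE COLLARED WITNESSES `θ₁₅ᶜᶜᴹᶻ(j) = theta13OfThm1CCMZ …` ∕ `θ₁₅ᶜᶜᴹᵂᶻ(j; γ) = theta13OfThm1CCMWZ …`, THEIR `rfl` BRIDGES TO THE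
# LANDED (COUPLING-BLIND) MEMBERS, AND THE ROWS G ∕ Z ∕ P12 ∕ P11-SOCKET AT THE Z WITNESSES — LETTER-GENERIC

Cell `ym-nodeO-ideate`, DEFINER seat `ym-nodeO-def-1` (gen 9), PEN NAMED BY THE PLAN OF RECORD (plan g86 `[YMPLAN-G86-ANSWER-218]`, pub-ymgap bus l.38303) on director-ym g10 №218
«FLAG №9 · K1-FACE DOOR WITNESS COUPLING-BLIND» (bus l.38254).  `--kind definition --supports stmt-QuantumFields-20541` (Literature Node00 lane; count-neutral).  Sibling «Z1» =
`Node00/Record12NumericsFamilyDictZ.lean` (the Stage-8∕12 Z-makers).  APPEND-ONLY discipline: a NEW module; every landed witness is the `(0, 0)` INSTANCE of its Z edition BY `rfl` (§3),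
so no downstream face re-keys.  [I] = [Balaban1987RG1], [III] = [Balaban1988Convergent], [IV] = [Balaban1989LargeFieldI], [V] = [Balaban1989LargeFieldII].

WHY.  The witnesses of record `theta13OfThm1CCM` ∕ `theta13OfThm1CCMW` (dag-n21-c, A1∕A1ʷ) are `theta13LiveOfNumerics F N n ε₂₉ ζ Rz Zt := (theta13OfNumerics …).liveRepin₁₃`
(K0a `Record13LiveSelectorFamily` :224 ∕ :257) over `stage12OfNumericsD`, whose fluctuation rows are the CLOSED `0` — the located COUPLING-BLIND defect (dag-n24-c g11; dag-n13-w3 g5 path (C);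
ref-H g24 A2-ADDENDUM; director-ym №218).  THIS FILE threads the two OPEN LETTERS through the Stage-13 layer: §1 `theta13OfNumericsZ n ε₂₉ ζ Rz Zt Efl logz := { stage12OfNumericsDZ … with
ε₂₉ }` and `theta13LiveOfNumericsZ := (…Z).liveRepin₁₃`; §2 the ROWS at every member of the Z family — row G (admissibility: `n.Pos ∧ 0 < ε₂₉`, letter-blind), `HasResidualsOfRecord`
(`⟨rfl, rfl, rfl⟩`: reads `ζ ∕ Rz ∕ Zt` only), row Z (`ZtUnity`), ★ row P12 (`SlotsNondegenerate₁₃`) HYPOTHESIS-FREE and ★ `Provisos₁₃` FROM ROW P11 ALONE — all by K0a's θ-GENERIC theorems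
over «the ₁₃ live re-pin of a parameter carrying K0b's residuals» (`Stage13Params.slotsNondegenerate₁₃_liveRepin_of_hasResiduals`, `Stage13Params.provisos₁₃_liveRepin₁₃_of_bg`,
`Admissible.liveRepin₁₃`, `HasResidualsOfRecord.liveRepin₁₃ ∕ .ztUnity`), hence LETTER-GENERIC in `(Efl, logz)` with NO displayed hypothesis on the letters (the plan's located worry
«faces reading `EOfRecord₁₃ θ` — densities, reps, slots — are not token-pass» is answered: those objects CARRY the letters, and the rows about them were proved θ-generically); §3 the
collared instances `theta13OfThm1CCMZ F N j ε₀ ε₂₉ B₃ B₃' a₀ a₁ Efl logz` ∕ `theta13OfThm1CCMWZ F N j γ ε₀ ε₂₉ B₃ B₃' a₀ a₁ Efl logz` with the BRIDGES `theta13OfNumerics_eq_Z`,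
`theta13LiveOfNumerics_eq_Z`, `theta13OfThm1CCM_eq_Z`, `theta13OfThm1CCMW_eq_Z` (`rfl`: the landed members are the `(0, 0)` instances) and `theta13OfThm1CCMWZ_half` (`rfl`); §4 their faces by
token-pass (`ν, εreg, A₀, p₀, r, M₂, M₁, ε₀, ε₂₉, γ, s2, cB, B, C, Mr, cR, βc, κ, τ9.M, A₁, Rz, ℓ₆`) + the NEW letter faces `_Efl ∕ _logz` + rows N1 ∕ G ∕ Z ∕ P12 ∕ `HasResidualsOfRecord`.
DOWNSTREAM (not this file's; token-pass for their owners): K0⁷'s body at θZ (k0-s1-w3, after FILE 4), N24 door closers at θZ (n24-c ∕ n24-w1), N13 AT θZ = real work (n13 lanes; №218 (4)).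

WHAT THIS FILE DOES NOT DO (by design; director-ym №126 precedent): it pins NO closed value of `E_k` or `log z_k` — OPEN LETTERS; NODE N13's theorem delivers the pair with the (1.15) [III] ∕
(0.15) [V] identities and bounds, and a K1⁹ prover instantiates the existential `θ` at the delivered pair.  FLAG №9 is NOT closed by this file (№218 (4)).

HONEST FRAMING.  A DEFINITION edition + instantiation of K0a's generic rows; NOTHING of Bałaban's is asserted; no proviso content is proved (the P11 `bg` row stays DISPLAYED); no
estimate; K0⁷ stmt-QuantumFields-20541 NOT discharged, its registered texts untouched (no re-cut); K1⁹ 27364 ∕ K3⁸ 27366 OPEN; no node count moves (typed 28∕28 · discharged 5∕27 (A 5∕28)).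
One finite four-torus programme at fixed `ε = L^{−K}` — NOT the continuum limit on ℝ⁴, NOT infinite volume, NOT OS, NOT a mass gap, NOT the Clay problem; R4 = the CONDITIONAL finite-𝕋⁴
rung `BalabanLadder.UV` only.  No `sorry`, no `axiom`, no `instance`, no `notation`.
-/

noncomputable section

open MeasureTheory
open scoped Matrix.Norms.L2Operator

namespace Literature.MathematicalPhysics.QuantumFieldTheory.Balaban1983to89.Node00

open T4Continuum AveragingRT T4FiniteEpsInhabited FlowStep FlowStepRuns DagBinding T4DatumAssembly B4GaugeCovariance

/-! ## §1. The all-numerics family WITH THE LETTERS: `theta13OfNumericsZ`, `theta13LiveOfNumericsZ` -/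

section AllNumericsZ

variable (F : T4Family) (N : ℕ) [NeZero N] (n : Stage12Numerics) (ε₂₉ : ℝ)
variable (ζ : ZetaOfRecord F N n.ν n.τ9.M) (Rz : (K : ℕ) → Sect2.Residual (F.P K) (MatA N)) (Zt : (K : ℕ) → TkResidualW F N (FluctV N) K)
variable (Efl logz : B12.RunParams → ℕ → ℝ)

/-- **THE STAGE-13 PARAMETER AT ARBITRARY NUMERICS `n` WITH THE FLUCTUATION LETTERS** (identity selector): the Z-maker `stage12OfNumericsDZ` at the dictionary OF THE FAMILY and `n`,
extended by `ε₂₉` — `theta13OfNumerics` (K0a) with `Efl`, `logz` as arguments. [cite: Balaban1987RG1, (0.1) p.251, (0.21) p.256, (2.9) p.266; Balaban1988Convergent, (1.15) p.249, (2.4) p.255, (2.10) p.256; Balaban1989LargeFieldII, (0.15) p.360 (parameter dictionary; bookkeeping witness)] -/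
def theta13OfNumericsZ : Stage13Params F N :=
  { stage12OfNumericsDZ F N (stage3OfFamily F) n (residual5OfRecord₁₂ F N) Efl logz ζ Rz Zt with ε₂₉ := ε₂₉ }

/-- The Z parameter's Stage-12 part IS the Z-maker's term (`rfl`). [cite: Balaban1988Convergent, (2.10) p.256 (bookkeeping)] -/
theorem theta13OfNumericsZ_toStage12Params :
    (theta13OfNumericsZ F N n ε₂₉ ζ Rz Zt Efl logz).toStage12Params = stage12OfNumericsDZ F N (stage3OfFamily F) n (residual5OfRecord₁₂ F N) Efl logz ζ Rz Zt := rfl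

/-- FACE (`rfl`): `Efl`. [cite: Balaban1988Convergent, (1.15) p.249 (bookkeeping)] -/
theorem theta13OfNumericsZ_Efl : (theta13OfNumericsZ F N n ε₂₉ ζ Rz Zt Efl logz).Efl = Efl := rfl

/-- FACE (`rfl`): `logz`. [cite: Balaban1989LargeFieldII, (0.15) p.360 (bookkeeping)] -/
theorem theta13OfNumericsZ_logz : (theta13OfNumericsZ F N n ε₂₉ ζ Rz Zt Efl logz).logz = logz := rfl

/-- FACE (`rfl`): the (2.9) letter. [cite: Balaban1987RG1, (2.9) p.266 (bookkeeping)] -/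
theorem theta13OfNumericsZ_ε₂₉ : (theta13OfNumericsZ F N n ε₂₉ ζ Rz Zt Efl logz).ε₂₉ = ε₂₉ := rfl

/-- FACE (`rfl`): Stage-7 numerics. [cite: Balaban1988Convergent, (2.4) p.255 (bookkeeping)] -/
theorem theta13OfNumericsZ_ν : (theta13OfNumericsZ F N n ε₂₉ ζ Rz Zt Efl logz).ν = n.ν := rfl

/-- FACE (`rfl`): §2 numerics. [cite: Balaban1988Convergent, (2.28) p.259 (bookkeeping)] -/
theorem theta13OfNumericsZ_s2 : (theta13OfNumericsZ F N n ε₂₉ ζ Rz Zt Efl logz).s2 = n.s2 := rfl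

/-- FACE (`rfl`): window. [cite: Balaban1987RG1, Thm 1 p.259 (bookkeeping)] -/
theorem theta13OfNumericsZ_γ : (theta13OfNumericsZ F N n ε₂₉ ζ Rz Zt Efl logz).γ = n.γ := rfl

/-- FACE (`rfl`): tower numerics. [cite: Balaban1989LargeFieldI, (0.3) p.176 (bookkeeping)] -/
theorem theta13OfNumericsZ_τ9 : (theta13OfNumericsZ F N n ε₂₉ ζ Rz Zt Efl logz).τ9 = n.τ9 := rfl

/-- FACE (`rfl`): `A₁`. [cite: Balaban1988Convergent, (3.16) p.268 (bookkeeping)] -/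
theorem theta13OfNumericsZ_A₁ : (theta13OfNumericsZ F N n ε₂₉ ζ Rz Zt Efl logz).A₁ = n.A₁ := rfl

/-- … block size of the family: `ℓ₆ + 1 = F.L`. [cite: Balaban1987RG1, (0.1) p.251 (bookkeeping)] -/
theorem theta13OfNumericsZ_ℓ₆_succ : (theta13OfNumericsZ F N n ε₂₉ ζ Rz Zt Efl logz).ℓ₆ + 1 = F.L := stage3OfFamily_ℓ₆_succ F

/-- **BRIDGE (`rfl`): `theta13OfNumerics = theta13OfNumericsZ … 0 0`** — the landed all-numerics parameter IS the coupling-blind member. [cite: Balaban1988Convergent, (2.10) p.256 (bookkeeping)] -/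
theorem theta13OfNumerics_eq_Z :
    theta13OfNumerics F N n ε₂₉ ζ Rz Zt = theta13OfNumericsZ F N n ε₂₉ ζ Rz Zt (fun _ _ => 0) (fun _ _ => 0) := rfl

variable {n ε₂₉} in
/-- **Row G: Stage-13 admissible ⟸ `n.Pos` ∧ `0 < ε₂₉`** — whatever the letters (`admissible_stage12OfNumericsDZ`). [cite: Balaban1987RG1, (0.21) p.256, (2.9) p.266; Balaban1988Convergent, (2.10) p.256 (bookkeeping)] -/
theorem admissible_theta13OfNumericsZ (hn : n.Pos) (hε' : 0 < ε₂₉) : (theta13OfNumericsZ F N n ε₂₉ ζ Rz Zt Efl logz).Admissible F N :=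
  ⟨admissible_stage12OfNumericsDZ F N (stage3OfFamily F) n (residual5OfRecord₁₂ F N) Efl logz ζ Rz Zt (admissible_stage3OfFamily F) hn, hε'⟩

/-- It carries K0b's residuals of record at `ζ := zeta316OfRecord F N n.ν n.τ9.M n.A₁` (`⟨rfl, rfl, rfl⟩` — the letters are not read). [cite: Balaban1988Convergent, (3.16) p.268, (2.21) p.258, (3.20) p.269 (bookkeeping)] -/
theorem hasResidualsOfRecord_theta13OfNumericsZ :
    (theta13OfNumericsZ F N n ε₂₉ (zeta316OfRecord F N n.ν n.τ9.M n.A₁) (RzOfRecord F N) (ZtOfRecord F N) Efl logz).HasResidualsOfRecord F N :=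
  ⟨rfl, rfl, rfl⟩

/-- **THE ALL-NUMERICS WITNESS FAMILY WITH THE LETTERS** `θ₁₃ᶻ(n, ε₂₉; Efl, logz) := θᶻ(n, ε₂₉; Efl, logz).liveRepin₁₃`. [cite: Balaban1989LargeFieldI, (0.3) p.176 and p.177 (bookkeeping witness)] -/
def theta13LiveOfNumericsZ : Stage13Params F N :=
  (theta13OfNumericsZ F N n ε₂₉ ζ Rz Zt Efl logz).liveRepin₁₃ F N

/-- Unfolding (`rfl`). [cite: Balaban1989LargeFieldI, (0.3) p.176 (bookkeeping)] -/
theorem theta13LiveOfNumericsZ_eq :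
    theta13LiveOfNumericsZ F N n ε₂₉ ζ Rz Zt Efl logz = (theta13OfNumericsZ F N n ε₂₉ ζ Rz Zt Efl logz).liveRepin₁₃ F N := rfl

/-- **BRIDGE (`rfl`): `theta13LiveOfNumerics = theta13LiveOfNumericsZ … 0 0`**. [cite: Balaban1989LargeFieldI, (0.3) p.176 (bookkeeping)] -/
theorem theta13LiveOfNumerics_eq_Z :
    theta13LiveOfNumerics F N n ε₂₉ ζ Rz Zt = theta13LiveOfNumericsZ F N n ε₂₉ ζ Rz Zt (fun _ _ => 0) (fun _ _ => 0) := rfl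

/-- FACE (`rfl`): the live witness's `Efl` letter (the re-pin changes the selector only). [cite: Balaban1988Convergent, (1.15) p.249 (bookkeeping)] -/
theorem theta13LiveOfNumericsZ_Efl : (theta13LiveOfNumericsZ F N n ε₂₉ ζ Rz Zt Efl logz).Efl = Efl := rfl

/-- FACE (`rfl`): the live witness's `logz` letter. [cite: Balaban1989LargeFieldII, (0.15) p.360 (bookkeeping)] -/
theorem theta13LiveOfNumericsZ_logz : (theta13LiveOfNumericsZ F N n ε₂₉ ζ Rz Zt Efl logz).logz = logz := rfl

/-- FACE (`rfl`): numerics. [cite: Balaban1988Convergent, (2.4) p.255 (bookkeeping)] -/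
theorem theta13LiveOfNumericsZ_ν : (theta13LiveOfNumericsZ F N n ε₂₉ ζ Rz Zt Efl logz).ν = n.ν := rfl

/-- FACE (`rfl`): window. [cite: Balaban1987RG1, Thm 1 p.259 (bookkeeping)] -/
theorem theta13LiveOfNumericsZ_γ : (theta13LiveOfNumericsZ F N n ε₂₉ ζ Rz Zt Efl logz).γ = n.γ := rfl

/-- FACE (`rfl`): (2.9) letter. [cite: Balaban1987RG1, (2.9) p.266 (bookkeeping)] -/
theorem theta13LiveOfNumericsZ_ε₂₉ : (theta13LiveOfNumericsZ F N n ε₂₉ ζ Rz Zt Efl logz).ε₂₉ = ε₂₉ := rfl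

/-- N10's Lemma-3 level-T binder at every Z member: `8 ≤ θ.ℓ₆ + 1`. [cite: Balaban1987RG1, (0.1) p.251; Balaban1988RG2Cluster, (2.36) p.19] -/
theorem eight_le_L_theta13LiveOfNumericsZ : 8 ≤ (theta13LiveOfNumericsZ F N n ε₂₉ ζ Rz Zt Efl logz).ℓ₆ + 1 := eight_le_L_stage3OfFamily F

variable {n ε₂₉} in
/-- **Row G at every Z member: Admissible ⟸ `n.Pos` ∧ `0 < ε₂₉`** (letter-blind). [cite: Balaban1987RG1, (0.21) p.256, (2.9) p.266; Balaban1988Convergent, (2.10) p.256 (bookkeeping)] -/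
theorem admissible_theta13LiveOfNumericsZ (hn : n.Pos) (hε' : 0 < ε₂₉) : (theta13LiveOfNumericsZ F N n ε₂₉ ζ Rz Zt Efl logz).Admissible F N :=
  (admissible_theta13OfNumericsZ F N ζ Rz Zt Efl logz hn hε').liveRepin₁₃

/-- At K0b's residuals every Z member carries them (`⟨rfl, rfl, rfl⟩`). [cite: Balaban1988Convergent, (3.16) p.268, (2.21) p.258, (3.20) p.269 (bookkeeping)] -/
theorem hasResidualsOfRecord_theta13LiveOfNumericsZ :
    (theta13LiveOfNumericsZ F N n ε₂₉ (zeta316OfRecord F N n.ν n.τ9.M n.A₁) (RzOfRecord F N) (ZtOfRecord F N) Efl logz).HasResidualsOfRecord F N :=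
  ⟨rfl, rfl, rfl⟩

/-- **Row Z (`ZtUnity`) at every Z member carrying K0b's residuals.** [cite: Balaban1988Convergent, (3.16)–(3.20) pp.268–269] -/
theorem ztUnity_theta13LiveOfNumericsZ :
    (theta13LiveOfNumericsZ F N n ε₂₉ (zeta316OfRecord F N n.ν n.τ9.M n.A₁) (RzOfRecord F N) (ZtOfRecord F N) Efl logz).ZtUnity F N :=
  (hasResidualsOfRecord_theta13LiveOfNumericsZ F N n ε₂₉ Efl logz).ztUnity

/-- **★ Row P12 at every Z member from `Provisos₁₃` there** (K0a's generic `slotsNondegenerate₁₃_liveRepin`). [cite: Balaban1988Convergent, (3.22) p.269, (3.24) p.270; Balaban1989LargeFieldI, (0.3)–(0.4) p.176] -/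
theorem slotsNondegenerate₁₃_theta13LiveOfNumericsZ (h : (theta13LiveOfNumericsZ F N n ε₂₉ ζ Rz Zt Efl logz).Provisos₁₃ F N) :
    (theta13LiveOfNumericsZ F N n ε₂₉ ζ Rz Zt Efl logz).SlotsNondegenerate₁₃ F N :=
  Stage13Params.slotsNondegenerate₁₃_liveRepin F N (theta13OfNumericsZ F N n ε₂₉ ζ Rz Zt Efl logz) h

/-- **★★ Row P12 at every Z member carrying K0b's residuals — HYPOTHESIS-FREE, LETTER-GENERIC** (K0a's `Stage13Params.slotsNondegenerate₁₃_liveRepin_of_hasResiduals`; no proviso, no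
letter read). [cite: Balaban1988Convergent, (3.22) p.269; Balaban1989LargeFieldI, (0.3)–(0.4) p.176 (bookkeeping)] -/
theorem slotsNondegenerate₁₃_theta13LiveOfNumericsZ_of_hasResiduals :
    (theta13LiveOfNumericsZ F N n ε₂₉ (zeta316OfRecord F N n.ν n.τ9.M n.A₁) (RzOfRecord F N) (ZtOfRecord F N) Efl logz).SlotsNondegenerate₁₃ F N :=
  Stage13Params.slotsNondegenerate₁₃_liveRepin_of_hasResiduals (θ := theta13OfNumericsZ F N n ε₂₉ _ _ _ Efl logz)
    (hasResidualsOfRecord_theta13OfNumericsZ F N n ε₂₉ Efl logz)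

/-- **★ `Provisos₁₃` at every Z member carrying K0b's residuals FROM ROW P11 ALONE** (K0a's generic `provisos₁₃_liveRepin₁₃_of_bg`; (H-U) by K0c's `localBgMeasurable`); the `bg`
row stays DISPLAYED. [cite: Balaban1988Convergent, (2.18) p.257, (2.28) p.259, (3.16) p.268, (3.22) p.269; Balaban1989LargeFieldI, (0.3)–(0.4) p.176 (bookkeeping)] -/
theorem provisos₁₃_theta13LiveOfNumericsZ_of_bg
    (hbg : ∀ (p : B12.RunParams) (m : ℕ), m ≤ p.K →
      Step.InInterval (theta13OfNumericsZ F N n ε₂₉ (zeta316OfRecord F N n.ν n.τ9.M n.A₁) (RzOfRecord F N) (ZtOfRecord F N) Efl logz).γ m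
        (gOfRecord₁₃ F N (theta13OfNumericsZ F N n ε₂₉ (zeta316OfRecord F N n.ν n.τ9.M n.A₁) (RzOfRecord F N) (ZtOfRecord F N) Efl logz) p) →
      BgProvisoΛ F N p.K
        (settingOfRecord₁₃ F N (theta13LiveOfNumericsZ F N n ε₂₉ (zeta316OfRecord F N n.ν n.τ9.M n.A₁) (RzOfRecord F N) (ZtOfRecord F N) Efl logz) p)
        (RzOfRecord F N p.K) n.τ9.M m
        (suppOfRecord₁₃ F N (theta13LiveOfNumericsZ F N n ε₂₉ (zeta316OfRecord F N n.ν n.τ9.M n.A₁) (RzOfRecord F N) (ZtOfRecord F N) Efl logz) p m)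
        (UbgOfRecord₁₃ F N (theta13LiveOfNumericsZ F N n ε₂₉ (zeta316OfRecord F N n.ν n.τ9.M n.A₁) (RzOfRecord F N) (ZtOfRecord F N) Efl logz) p m)) :
    (theta13LiveOfNumericsZ F N n ε₂₉ (zeta316OfRecord F N n.ν n.τ9.M n.A₁) (RzOfRecord F N) (ZtOfRecord F N) Efl logz).Provisos₁₃ F N :=
  (theta13OfNumericsZ F N n ε₂₉ _ _ _ Efl logz).provisos₁₃_liveRepin₁₃_of_bg (hasResidualsOfRecord_theta13OfNumericsZ F N n ε₂₉ Efl logz) hbg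

end AllNumericsZ

/-! ## §3. The collared z-witnesses `θ₁₅ᶜᶜᴹᶻ(j)` ∕ `θ₁₅ᶜᶜᴹᵂᶻ(j; γ)` and their bridges -/

section WitnessZ

variable (F : T4Family) (N : ℕ) [NeZero N] (j : ℕ) (γ ε₀ ε₂₉ B₃ B₃' a₀ a₁ : ℝ) (Efl logz : B12.RunParams → ℕ → ℝ)

/-- **THE COLLARED STAGE-13 z-WITNESS** `θ₁₅ᶜᶜᴹᶻ(j; ε₀, ε₂₉; B₃, B₃′, a₀, a₁; Efl, logz)`: A1's `theta13OfThm1CCM` (dag-n21-c) with the per-run fluctuation constants `E_k`, `log z_k`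
as OPEN LETTERS — the Z family at `stage12NumericsOfThm1CCM F.L j ε₀ B₃ B₃' a₀ a₁` with K0b's residuals of record. [cite: Balaban1989LargeFieldI, (0.3) p.176; Balaban1988Convergent, (1.15) p.249, (2.4) p.255, (2.10) p.256, (2.28) p.259; Balaban1989LargeFieldII, (0.15) p.360; Balaban1987RG1, (1.12) p.262 (bookkeeping witness)] -/
def theta13OfThm1CCMZ : Stage13Params F N :=
  theta13LiveOfNumericsZ F N (stage12NumericsOfThm1CCM F.L j ε₀ B₃ B₃' a₀ a₁) ε₂₉
    (zeta316OfRecord F N (stage12NumericsOfThm1CCM F.L j ε₀ B₃ B₃' a₀ a₁).ν (stage12NumericsOfThm1CCM F.L j ε₀ B₃ B₃' a₀ a₁).τ9.M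
      (stage12NumericsOfThm1CCM F.L j ε₀ B₃ B₃' a₀ a₁).A₁)
    (RzOfRecord F N) (ZtOfRecord F N) Efl logz

/-- **THE WINDOWED COLLARED STAGE-13 z-WITNESS** `θ₁₅ᶜᶜᴹᵂᶻ(j; γ; …; Efl, logz)`: A1ʷ's `theta13OfThm1CCMW` with the letters. [cite: Balaban1989LargeFieldI, (0.3) p.176; Balaban1987RG1, Thm 1 p.259; Balaban1988Convergent, (1.15) p.249, (2.4) p.255; Balaban1989LargeFieldII, (0.15) p.360 (bookkeeping witness)] -/
def theta13OfThm1CCMWZ : Stage13Params F N :=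
  theta13LiveOfNumericsZ F N (stage12NumericsOfThm1CCMW F.L j γ ε₀ B₃ B₃' a₀ a₁) ε₂₉
    (zeta316OfRecord F N (stage12NumericsOfThm1CCMW F.L j γ ε₀ B₃ B₃' a₀ a₁).ν (stage12NumericsOfThm1CCMW F.L j γ ε₀ B₃ B₃' a₀ a₁).τ9.M
      (stage12NumericsOfThm1CCMW F.L j γ ε₀ B₃ B₃' a₀ a₁).A₁)
    (RzOfRecord F N) (ZtOfRecord F N) Efl logz

/-- **BRIDGE (`rfl`): `theta13OfThm1CCM = theta13OfThm1CCMZ … 0 0`** — A1's witness of record IS the coupling-blind member (the one path (C) retires). [cite: Balaban1989LargeFieldI, (0.3) p.176 (bookkeeping)] -/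
theorem theta13OfThm1CCM_eq_Z :
    theta13OfThm1CCM F N j ε₀ ε₂₉ B₃ B₃' a₀ a₁ = theta13OfThm1CCMZ F N j ε₀ ε₂₉ B₃ B₃' a₀ a₁ (fun _ _ => 0) (fun _ _ => 0) := rfl

/-- **BRIDGE (`rfl`): `theta13OfThm1CCMW = theta13OfThm1CCMWZ … 0 0`**. [cite: Balaban1989LargeFieldI, (0.3) p.176 (bookkeeping)] -/
theorem theta13OfThm1CCMW_eq_Z :
    theta13OfThm1CCMW F N j γ ε₀ ε₂₉ B₃ B₃' a₀ a₁ = theta13OfThm1CCMWZ F N j γ ε₀ ε₂₉ B₃ B₃' a₀ a₁ (fun _ _ => 0) (fun _ _ => 0) := rfl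

/-- **The `γ = ½` member of the windowed Z family IS the collared Z witness** (`rfl`). [cite: Balaban1987RG1, Thm 1 p.259 (bookkeeping)] -/
theorem theta13OfThm1CCMWZ_half :
    theta13OfThm1CCMWZ F N j (1 / 2) ε₀ ε₂₉ B₃ B₃' a₀ a₁ Efl logz = theta13OfThm1CCMZ F N j ε₀ ε₂₉ B₃ B₃' a₀ a₁ Efl logz := rfl

/-! ## §4. Faces at the z-witnesses (token-pass) + the letter faces + rows N1 ∕ G ∕ Z ∕ P12 -/

/-- FACE (`rfl`): `θ₁₅ᶜᶜᴹᶻ.Efl = Efl`. [cite: Balaban1988Convergent, (1.15) p.249 (bookkeeping)] -/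
theorem theta13OfThm1CCMZ_Efl : (theta13OfThm1CCMZ F N j ε₀ ε₂₉ B₃ B₃' a₀ a₁ Efl logz).Efl = Efl := rfl

/-- FACE (`rfl`): `θ₁₅ᶜᶜᴹᶻ.logz = logz`. [cite: Balaban1989LargeFieldII, (0.15) p.360 (bookkeeping)] -/
theorem theta13OfThm1CCMZ_logz : (theta13OfThm1CCMZ F N j ε₀ ε₂₉ B₃ B₃' a₀ a₁ Efl logz).logz = logz := rfl

/-- FACE (`rfl`): `θ₁₅ᶜᶜᴹᵂᶻ.Efl = Efl`. [cite: Balaban1988Convergent, (1.15) p.249 (bookkeeping)] -/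
theorem theta13OfThm1CCMWZ_Efl : (theta13OfThm1CCMWZ F N j γ ε₀ ε₂₉ B₃ B₃' a₀ a₁ Efl logz).Efl = Efl := rfl

/-- FACE (`rfl`): `θ₁₅ᶜᶜᴹᵂᶻ.logz = logz`. [cite: Balaban1989LargeFieldII, (0.15) p.360 (bookkeeping)] -/
theorem theta13OfThm1CCMWZ_logz : (theta13OfThm1CCMWZ F N j γ ε₀ ε₂₉ B₃ B₃' a₀ a₁ Efl logz).logz = logz := rfl

/-- FACE (`rfl`): numerics — the landed witness's. [cite: Balaban1988Convergent, (2.4) p.255 (bookkeeping)] -/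
theorem theta13OfThm1CCMZ_ν : (theta13OfThm1CCMZ F N j ε₀ ε₂₉ B₃ B₃' a₀ a₁ Efl logz).ν = numerics7OfThm1CCM F.L j ε₀ B₃ B₃' a₀ a₁ := rfl

/-- FACE (`rfl`): `ν.εreg = a₀`. [cite: Balaban1985RegularSpaces, (1.3)–(1.6) p.77 (bookkeeping)] -/
theorem theta13OfThm1CCMZ_εreg : (theta13OfThm1CCMZ F N j ε₀ ε₂₉ B₃ B₃' a₀ a₁ Efl logz).ν.εreg = a₀ := rfl

/-- FACE (`rfl`): `ν.A₀`. [cite: Balaban1985Variational, Thm 1 p.279 (bookkeeping)] -/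
theorem theta13OfThm1CCMZ_A₀ : (theta13OfThm1CCMZ F N j ε₀ ε₂₉ B₃ B₃' a₀ a₁ Efl logz).ν.A₀ = A0OfThm1CC1 F.L B₃ B₃' a₀ a₁ := rfl

/-- FACE (`rfl`): `ν.M₁ = F.L ^ j`. [cite: Balaban1989LargeFieldI, p.177 (bookkeeping)] -/
theorem theta13OfThm1CCMZ_M₁ : (theta13OfThm1CCMZ F N j ε₀ ε₂₉ B₃ B₃' a₀ a₁ Efl logz).ν.M₁ = F.L ^ j := rfl

/-- FACE (`rfl`): `ν.M₂ = 1`. [cite: Balaban1989LargeFieldI, p.177 (bookkeeping)] -/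
theorem theta13OfThm1CCMZ_M₂ : (theta13OfThm1CCMZ F N j ε₀ ε₂₉ B₃ B₃' a₀ a₁ Efl logz).ν.M₂ = 1 := rfl

/-- FACE (`rfl`): `ν.p₀ = 1`. [cite: Balaban1985RegularSpaces, Prop. 6 p.99 (bookkeeping)] -/
theorem theta13OfThm1CCMZ_p₀ : (theta13OfThm1CCMZ F N j ε₀ ε₂₉ B₃ B₃' a₀ a₁ Efl logz).ν.p₀ = 1 := rfl

/-- FACE (`rfl`): `ν.r = 1`. [cite: Balaban1985RegularSpaces, Prop. 6 p.99 (bookkeeping)] -/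
theorem theta13OfThm1CCMZ_r : (theta13OfThm1CCMZ F N j ε₀ ε₂₉ B₃ B₃' a₀ a₁ Efl logz).ν.r = 1 := rfl

/-- FACE (`rfl`): `ν.ε₀ = ε₀`. [cite: Balaban1987RG1, (1.2) p.260 (bookkeeping)] -/
theorem theta13OfThm1CCMZ_ε₀ : (theta13OfThm1CCMZ F N j ε₀ ε₂₉ B₃ B₃' a₀ a₁ Efl logz).ν.ε₀ = ε₀ := rfl

/-- FACE (`rfl`): `ε₂₉`. [cite: Balaban1987RG1, (2.9) p.266 (bookkeeping)] -/
theorem theta13OfThm1CCMZ_ε₂₉ : (theta13OfThm1CCMZ F N j ε₀ ε₂₉ B₃ B₃' a₀ a₁ Efl logz).ε₂₉ = ε₂₉ := rfl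

/-- FACE (`rfl`): window `½`. [cite: Balaban1987RG1, Thm 1 p.259 (bookkeeping)] -/
theorem theta13OfThm1CCMZ_γ : (theta13OfThm1CCMZ F N j ε₀ ε₂₉ B₃ B₃' a₀ a₁ Efl logz).γ = 1 / 2 := rfl

/-- FACE (`rfl`): `θ₁₅ᶜᶜᴹᵂᶻ.γ = γ`. [cite: Balaban1987RG1, Thm 1 p.259 (bookkeeping)] -/
theorem theta13OfThm1CCMWZ_γ : (theta13OfThm1CCMWZ F N j γ ε₀ ε₂₉ B₃ B₃' a₀ a₁ Efl logz).γ = γ := rfl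

/-- FACE (`rfl`): `θ₁₅ᶜᶜᴹᵂᶻ.ν` = the landed windowed witness's. [cite: Balaban1988Convergent, (2.4) p.255 (bookkeeping)] -/
theorem theta13OfThm1CCMWZ_ν : (theta13OfThm1CCMWZ F N j γ ε₀ ε₂₉ B₃ B₃' a₀ a₁ Efl logz).ν = numerics7OfThm1CCM F.L j ε₀ B₃ B₃' a₀ a₁ := rfl

/-- FACE (`rfl`): §2 numerics. [cite: Balaban1988Convergent, (2.28) p.259 (bookkeeping)] -/
theorem theta13OfThm1CCMZ_s2 : (theta13OfThm1CCMZ F N j ε₀ ε₂₉ B₃ B₃' a₀ a₁ Efl logz).s2 = sect2NumericsOfThm1C F.L := rfl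

/-- FACE (`rfl`): `s2.cB = 6L + 1`. [cite: Balaban1988Convergent, (2.28) p.259 (bookkeeping)] -/
theorem theta13OfThm1CCMZ_cB : (theta13OfThm1CCMZ F N j ε₀ ε₂₉ B₃ B₃' a₀ a₁ Efl logz).s2.cB = 6 * F.L + 1 := rfl

/-- FACE (`rfl`): `s2.B = 7`. [cite: Balaban1988Convergent, (2.28) p.259 (bookkeeping)] -/
theorem theta13OfThm1CCMZ_B : (theta13OfThm1CCMZ F N j ε₀ ε₂₉ B₃ B₃' a₀ a₁ Efl logz).s2.B = 7 := rfl

/-- FACE (`rfl`): `s2.C = 1`. [cite: Balaban1988Convergent, (2.28) p.259 (bookkeeping)] -/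
theorem theta13OfThm1CCMZ_C : (theta13OfThm1CCMZ F N j ε₀ ε₂₉ B₃ B₃' a₀ a₁ Efl logz).s2.C = 1 := rfl

/-- FACE (`rfl`): `s2.Mr = 1`. [cite: Balaban1988Convergent, (2.28) p.259 (bookkeeping)] -/
theorem theta13OfThm1CCMZ_Mr : (theta13OfThm1CCMZ F N j ε₀ ε₂₉ B₃ B₃' a₀ a₁ Efl logz).s2.Mr = 1 := rfl

/-- FACE (`rfl`): `s2.cR = 1`. [cite: Balaban1988Convergent, (2.21) p.258 (bookkeeping)] -/
theorem theta13OfThm1CCMZ_cR : (theta13OfThm1CCMZ F N j ε₀ ε₂₉ B₃ B₃' a₀ a₁ Efl logz).s2.cR = 1 := rfl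

/-- FACE (`rfl`): `s2.βc = ¼`. [cite: Balaban1988Convergent, (2.28) p.259 (bookkeeping)] -/
theorem theta13OfThm1CCMZ_βc : (theta13OfThm1CCMZ F N j ε₀ ε₂₉ B₃ B₃' a₀ a₁ Efl logz).s2.βc = 1 / 4 := rfl

/-- FACE (`rfl`): `κ = 2·10⁴`. [cite: Balaban1987RG1, (1.18) p.263 (bookkeeping numeral)] -/
theorem theta13OfThm1CCMZ_κ : (theta13OfThm1CCMZ F N j ε₀ ε₂₉ B₃ B₃' a₀ a₁ Efl logz).s2.lf.κ = 20000 := rfl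

/-- FACE (`rfl`): `τ9.M = F.L ^ j` — [I]'s cube letter. [cite: Balaban1989LargeFieldI, (i)–(ii) p.177; Balaban1988Convergent, (2.1) p.254; Balaban1987RG1, (1.12) p.262 (bookkeeping)] -/
theorem theta13OfThm1CCMZ_τ9_M : (theta13OfThm1CCMZ F N j ε₀ ε₂₉ B₃ B₃' a₀ a₁ Efl logz).τ9.M = F.L ^ j := rfl

/-- FACE (`rfl`): `A₁ = 1`. [cite: Balaban1987RG1, (1.16) p.262 (bookkeeping)] -/
theorem theta13OfThm1CCMZ_A₁ : (theta13OfThm1CCMZ F N j ε₀ ε₂₉ B₃ B₃' a₀ a₁ Efl logz).A₁ = 1 := rfl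

/-- FACE (`rfl`): `Rz = RzOfRecord`. [cite: Balaban1988Convergent, (2.21) p.258 (bookkeeping)] -/
theorem theta13OfThm1CCMZ_Rz : (theta13OfThm1CCMZ F N j ε₀ ε₂₉ B₃ B₃' a₀ a₁ Efl logz).Rz = RzOfRecord F N := rfl

/-- `θ₁₅ᶜᶜᴹᶻ.ℓ₆ + 1 = F.L`. [cite: Balaban1987RG1, (0.1) p.251 (bookkeeping)] -/
theorem theta13OfThm1CCMZ_ℓ₆_succ : (theta13OfThm1CCMZ F N j ε₀ ε₂₉ B₃ B₃' a₀ a₁ Efl logz).ℓ₆ + 1 = F.L := stage3OfFamily_ℓ₆_succ F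

/-- `θ₁₅ᶜᶜᴹᵂᶻ.ℓ₆ + 1 = F.L`. [cite: Balaban1987RG1, (0.1) p.251 (bookkeeping)] -/
theorem theta13OfThm1CCMWZ_ℓ₆_succ : (theta13OfThm1CCMWZ F N j γ ε₀ ε₂₉ B₃ B₃' a₀ a₁ Efl logz).ℓ₆ + 1 = F.L := stage3OfFamily_ℓ₆_succ F

/-- N10's level-T binder at `θ₁₅ᶜᶜᴹᶻ`: `8 ≤ θ.ℓ₆ + 1`. [cite: Balaban1987RG1, (0.1) p.251; Balaban1988RG2Cluster, (2.36) p.19] -/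
theorem eight_le_L_theta13OfThm1CCMZ : 8 ≤ (theta13OfThm1CCMZ F N j ε₀ ε₂₉ B₃ B₃' a₀ a₁ Efl logz).ℓ₆ + 1 := eight_le_L_stage3OfFamily F

/-- Row N1 at `θ₁₅ᶜᶜᴹᶻ`: the (D4) `tree` numeral. [cite: Balaban1987RG1, (0.25)–(0.26) p.257] -/
theorem kp_tree_theta13OfThm1CCMZ : 128 * Real.log 162 ≤ (theta13OfThm1CCMZ F N j ε₀ ε₂₉ B₃ B₃' a₀ a₁ Efl logz).s2.lf.κ := kp_tree_lfConstsOfFamily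

/-- Row N1 at `θ₁₅ᶜᶜᴹᶻ`: the (D4) `large` numeral at the family's block size. [cite: Balaban1987RG1, (0.25)–(0.26) p.257; Balaban1988RG2Cluster, p.21 (after (2.39))] -/
theorem kp_large_theta13OfThm1CCMZ :
    10 * (64 * Real.log 162 + 1) ≤
      (((((theta13OfThm1CCMZ F N j ε₀ ε₂₉ B₃ B₃' a₀ a₁ Efl logz).ℓ₆ + 1 : ℕ) : ℝ)) / 2 - 1) * (theta13OfThm1CCMZ F N j ε₀ ε₂₉ B₃ B₃' a₀ a₁ Efl logz).s2.lf.κ :=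
  kp_large_theta13OfThm1CCM F N j ε₀ ε₂₉ B₃ B₃' a₀ a₁

/-- Row N1 at `θ₁₅ᶜᶜᴹᶻ`: N10's rate threshold. [cite: Balaban1987RG1, (1.18) p.263 (bookkeeping numeral)] -/
theorem kp_n10_theta13OfThm1CCMZ : (2 * 10 ^ 4 : ℝ) ≤ (theta13OfThm1CCMZ F N j ε₀ ε₂₉ B₃ B₃' a₀ a₁ Efl logz).s2.lf.κ := kp_n10_lfConstsOfFamily

/-- `θ₁₅ᶜᶜᴹᶻ` carries K0b's residuals of record (`⟨rfl, rfl, rfl⟩`). [cite: Balaban1988Convergent, (3.16) p.268, (2.21) p.258, (3.20) p.269 (bookkeeping)] -/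
theorem hasResidualsOfRecord_theta13OfThm1CCMZ : (theta13OfThm1CCMZ F N j ε₀ ε₂₉ B₃ B₃' a₀ a₁ Efl logz).HasResidualsOfRecord F N :=
  hasResidualsOfRecord_theta13LiveOfNumericsZ F N (stage12NumericsOfThm1CCM F.L j ε₀ B₃ B₃' a₀ a₁) ε₂₉ Efl logz

/-- `θ₁₅ᶜᶜᴹᵂᶻ` carries K0b's residuals of record (`⟨rfl, rfl, rfl⟩`). [cite: Balaban1988Convergent, (3.16) p.268, (2.21) p.258, (3.20) p.269 (bookkeeping)] -/
theorem hasResidualsOfRecord_theta13OfThm1CCMWZ : (theta13OfThm1CCMWZ F N j γ ε₀ ε₂₉ B₃ B₃' a₀ a₁ Efl logz).HasResidualsOfRecord F N :=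
  hasResidualsOfRecord_theta13LiveOfNumericsZ F N (stage12NumericsOfThm1CCMW F.L j γ ε₀ B₃ B₃' a₀ a₁) ε₂₉ Efl logz

/-- **Row Z (`ZtUnity`) at `θ₁₅ᶜᶜᴹᶻ`.** [cite: Balaban1988Convergent, (3.16)–(3.20) pp.268–269] -/
theorem ztUnity_theta13OfThm1CCMZ : (theta13OfThm1CCMZ F N j ε₀ ε₂₉ B₃ B₃' a₀ a₁ Efl logz).ZtUnity F N :=
  ztUnity_theta13LiveOfNumericsZ F N (stage12NumericsOfThm1CCM F.L j ε₀ B₃ B₃' a₀ a₁) ε₂₉ Efl logz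

/-- **Row Z (`ZtUnity`) at `θ₁₅ᶜᶜᴹᵂᶻ`.** [cite: Balaban1988Convergent, (3.16)–(3.20) pp.268–269] -/
theorem ztUnity_theta13OfThm1CCMWZ : (theta13OfThm1CCMWZ F N j γ ε₀ ε₂₉ B₃ B₃' a₀ a₁ Efl logz).ZtUnity F N :=
  ztUnity_theta13LiveOfNumericsZ F N (stage12NumericsOfThm1CCMW F.L j γ ε₀ B₃ B₃' a₀ a₁) ε₂₉ Efl logz

variable {j ε₀ ε₂₉ B₃ B₃' a₀ a₁} in
/-- **Row G: `θ₁₅ᶜᶜᴹᶻ` IS STAGE-13 ADMISSIBLE under the signs `0 < ε₀`, `0 < ε₂₉`, `0 ≤ B₃`, `0 ≤ B₃′`, `0 < a₀`, `0 < a₁`** — whatever the letters. [cite: Balaban1987RG1, (0.21) p.256, (1.2) p.260, (2.9) p.266; Balaban1988Convergent, (2.10) p.256, (2.28) p.259 (bookkeeping)] -/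
theorem admissible_theta13OfThm1CCMZ (hε : 0 < ε₀) (hε' : 0 < ε₂₉) (hB : 0 ≤ B₃) (hB' : 0 ≤ B₃') (ha₀ : 0 < a₀) (ha₁ : 0 < a₁) :
    (theta13OfThm1CCMZ F N j ε₀ ε₂₉ B₃ B₃' a₀ a₁ Efl logz).Admissible F N :=
  admissible_theta13LiveOfNumericsZ F N _ _ _ Efl logz (stage12NumericsOfThm1CCM_pos F.hL.2.le hε hB hB' ha₀ ha₁) hε'

variable {j γ ε₀ ε₂₉ B₃ B₃' a₀ a₁} in
/-- **Row G: `θ₁₅ᶜᶜᴹᵂᶻ` IS STAGE-13 ADMISSIBLE under `0 < γ < 1` and the signs** — whatever the letters. [cite: Balaban1987RG1, Thm 1 p.259, (0.21) p.256, (2.9) p.266; Balaban1988Convergent, (2.10) p.256 (bookkeeping)] -/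
theorem admissible_theta13OfThm1CCMWZ (hγ0 : 0 < γ) (hγ1 : γ < 1) (hε : 0 < ε₀) (hε' : 0 < ε₂₉) (hB : 0 ≤ B₃) (hB' : 0 ≤ B₃') (ha₀ : 0 < a₀) (ha₁ : 0 < a₁) :
    (theta13OfThm1CCMWZ F N j γ ε₀ ε₂₉ B₃ B₃' a₀ a₁ Efl logz).Admissible F N :=
  admissible_theta13LiveOfNumericsZ F N _ _ _ Efl logz (stage12NumericsOfThm1CCMW_pos F.hL.2.le hγ0 hγ1 hε hB hB' ha₀ ha₁) hε'

variable {j γ ε₀ ε₂₉ B₃ B₃' a₀ a₁} in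
/-- … in particular on the range `0 < γ ≤ ½` of the window letter. [cite: Balaban1987RG1, Thm 1 p.259 (bookkeeping)] -/
theorem admissible_theta13OfThm1CCMWZ_of_le_half (hγ0 : 0 < γ) (hγ : γ ≤ 1 / 2) (hε : 0 < ε₀) (hε' : 0 < ε₂₉) (hB : 0 ≤ B₃) (hB' : 0 ≤ B₃') (ha₀ : 0 < a₀) (ha₁ : 0 < a₁) :
    (theta13OfThm1CCMWZ F N j γ ε₀ ε₂₉ B₃ B₃' a₀ a₁ Efl logz).Admissible F N :=
  admissible_theta13OfThm1CCMWZ F N Efl logz hγ0 (hγ.trans_lt (by norm_num)) hε hε' hB hB' ha₀ ha₁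

/-- **★ Row P12 at `θ₁₅ᶜᶜᴹᶻ` HYPOTHESIS-FREE, LETTER-GENERIC.** [cite: Balaban1988Convergent, (3.22) p.269, (3.24) p.270; Balaban1989LargeFieldI, (0.3)–(0.4) p.176] -/
theorem slotsNondegenerate₁₃_theta13OfThm1CCMZ : (theta13OfThm1CCMZ F N j ε₀ ε₂₉ B₃ B₃' a₀ a₁ Efl logz).SlotsNondegenerate₁₃ F N :=
  slotsNondegenerate₁₃_theta13LiveOfNumericsZ_of_hasResiduals F N (stage12NumericsOfThm1CCM F.L j ε₀ B₃ B₃' a₀ a₁) ε₂₉ Efl logz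

/-- **★ Row P12 at `θ₁₅ᶜᶜᴹᵂᶻ` HYPOTHESIS-FREE, LETTER-GENERIC.** [cite: Balaban1988Convergent, (3.22) p.269, (3.24) p.270; Balaban1989LargeFieldI, (0.3)–(0.4) p.176] -/
theorem slotsNondegenerate₁₃_theta13OfThm1CCMWZ : (theta13OfThm1CCMWZ F N j γ ε₀ ε₂₉ B₃ B₃' a₀ a₁ Efl logz).SlotsNondegenerate₁₃ F N :=
  slotsNondegenerate₁₃_theta13LiveOfNumericsZ_of_hasResiduals F N (stage12NumericsOfThm1CCMW F.L j γ ε₀ B₃ B₃' a₀ a₁) ε₂₉ Efl logz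

end WitnessZ

end Literature.MathematicalPhysics.QuantumFieldTheory.Balaban1983to89.Node00

end
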